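/-
Copyright: the b2b-balaban T⁴-continuum CRUX team, row NE7b OWNER lineage `t4-ne7b-p1` (gen 142). Project licence.
-/
import Summits.QuantumFields.BalabanUV.T4Continuum.Spine.NE7b.SupFourthCumulantForm

/-!
# THE SCALAR THIRD-DERIVATIVE EXPRESSION IS FRÉCHET-DIFFERENTIABLE IN THE BACKGROUND, AND ITS DERIVATIVE ON A DIRECTION IS (521)'s CENTRED
# DISPLAY (the `C⁴` repackaging, first file).  (472) wrote `T(ψ)[h,k,l]` ((419)'s trilinear third derivative of the next potential applied to
# three directions) as the scalar expression `Z⁻¹Φ + Z⁻²(G_hH_kl + G_kH_hl + H_hkG_l) + 2Z⁻³G_hG_kG_l` in tilted moments; (514)∕(515) proved every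
# constituent Fréchet-differentiable in `ψ`; (516)∕(521) computed the derivative ALONG LINES and put it in centred form.  Here: (§1) the scalar
# expression is `DifferentiableAt` every background (`fun_prop` over the constituents, `Z > 0`), and (§2) its Fréchet derivative applied to any
# direction `m` EQUALS the centred display — by restricting to the line `ψ₀ + sm` ((516) `hasDerivAt_along_line`) and uniqueness of one-variable
# derivatives against (521).  So the entries `ψ ↦ T(ψ)[e_x,e_y,e_z]` are `C¹` with known derivative, which the next file lifts to the trilinear
# map itself (row NE7b, node U5c; (514), (515), (516), (521), (410) BY NAME; [folklore])

Cell `pub-balaban`, sub-cell `t4`, spine estimate NE7b (`T4WeightBudget.RelWeightBound`; the cell's OWN estimate — NOT PRINTED in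
[Bałaban 1983–89], NOT PROVED).  Crux-route work under `Spine/NE7b/` by the row OWNER (`t4-ne7b-p1` gen 142, file (532)) under FREEZE
(0)'s crux-prover clause; NOTHING of Bałaban's is named as a Lean object, valued or asserted; no `T4Continuum/Support` leaf typed; no
`def`, no notation (the expression and the display WRITTEN OUT); zero `sorry`.  Imports (BY NAME): the OWNER's (521) `…SupFourthCumulantForm`
(`hasDerivAt_third_form_line_centred`; through it (516) `hasDerivAt_along_line`, (515) `hasFDerivAt_Phi_scalar`, (514) `hasFDerivAt_Z_scalar`,
`hasFDerivAt_G_scalar`, `hasFDerivAt_H_scalar`, (410) `block_Z_pos`).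

WHAT IS PROVED ([folklore]): §1 **`differentiableAt_third_form`**; §2 **`fderiv_third_form_apply`**; §3 toy.

HONEST (what this is NOT).  Differentiability of the scalar entries and the value of their derivative; the lift to the trilinear map, its
`HasFDerivAt` and the operator letter of the fourth derivative are the next file.  Scalar skeleton ((A3), NC-NE7b-α UNRULED); nothing of
Bałaban's asserted.  BY-NAME EFFECT ON THE WALL: NONE.  NE7b NOT PRINTED ∕ NOT PROVED; spine PROVED 0∕9; rung (B)+1 — the programme's measures
remain FINITE-torus statements; NOT the mass gap, NOT Clay.  HONEST DEPENDENCY: continuum YM on T⁴ ⇐ BetaPertH ∧ nine spine estimates (0∕9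
proved); BetaPertH ⇐ (D1) ∧ (D4) ∧ CAP+tail; G-an2-4 gates asym, D1 and NE2∕3∕4.
-/

set_option autoImplicit false
set_option maxSynthPendingDepth 3

noncomputable section

namespace Summit.QuantumFields.BalabanUV.T4Continuum.NE7b.SupThirdFormDifferentiable

open MeasureTheory ProbabilityTheory Finset Real Metric Filter
open scoped BigOperators Topology
open SupBlockDressedStep (block_Z_pos)
open SupTiltedMomentConstituents (hasFDerivAt_Z_scalar hasFDerivAt_G_scalar hasFDerivAt_H_scalar)
open SupTiltedMomentPhiConstituent (hasFDerivAt_Phi_scalar)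
open SupFourthDerivativeRaw (hasDerivAt_along_line)
open SupFourthCumulantForm (hasDerivAt_third_form_line_centred)

variable {ι : Type} [Fintype ι] [DecidableEq ι]

section Main

variable {Γ : Matrix ι ι ℝ} {γop : ℝ} {U : EuclideanSpace ℝ ι → ℝ} {U' : EuclideanSpace ℝ ι → EuclideanSpace ℝ ι →L[ℝ] ℝ}
  {U'' : EuclideanSpace ℝ ι → EuclideanSpace ℝ ι →L[ℝ] EuclideanSpace ℝ ι →L[ℝ] ℝ}
  {U₃ : EuclideanSpace ℝ ι → EuclideanSpace ℝ ι →L[ℝ] EuclideanSpace ℝ ι →L[ℝ] EuclideanSpace ℝ ι →L[ℝ] ℝ}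
  {U₄ : EuclideanSpace ℝ ι → EuclideanSpace ℝ ι →L[ℝ] EuclideanSpace ℝ ι →L[ℝ] EuclideanSpace ℝ ι →L[ℝ] EuclideanSpace ℝ ι →L[ℝ] ℝ}
  {κ₀ κ₁ κ₂ κ₃ κ₄ a τ δ θ : ℝ} {h k l : EuclideanSpace ℝ ι}

/-! ## §1. Differentiability in the background -/

/-- **The scalar third-derivative expression is Fréchet-differentiable at every background** (directions `‖h‖, ‖k‖, ‖l‖ ≤ 1`). [folklore] -/
theorem differentiableAt_third_form (hΓ : Γ.PosSemidef) (hΓop : (γop • (1 : Matrix ι ι ℝ) - Γ).PosSemidef) (Y : Finset ι)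
    (hUd : ∀ φ : EuclideanSpace ℝ ι, HasFDerivAt U (U' φ) φ) (hU'd : ∀ φ : EuclideanSpace ℝ ι, HasFDerivAt U' (U'' φ) φ)
    (hU''d : ∀ φ : EuclideanSpace ℝ ι, HasFDerivAt U'' (U₃ φ) φ) (hU₃d : ∀ φ : EuclideanSpace ℝ ι, HasFDerivAt U₃ (U₄ φ) φ) (hU₄c : Continuous U₄)
    (hκ₀ : 0 ≤ κ₀) (hκ₁ : 0 ≤ κ₁) (ha : 0 ≤ a) (hτ : 0 < τ) (hδ : 0 < δ) (hθ1 : θ < 1) (hκθ : (2 * κ₀ * (1 + τ) + 4 * δ) * γop ≤ θ)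
    (hstab : ∀ φ : EuclideanSpace ℝ ι, -(κ₀ * ∑ x ∈ Y, φ x ^ 2) ≤ U φ) (hU'b : ∀ φ : EuclideanSpace ℝ ι, ‖U' φ‖ ≤ κ₁ * (a + ∑ x ∈ Y, φ x ^ 2)) (hθ0 :
        0 < θ) (hU''b : ∀ φ : EuclideanSpace ℝ ι, ‖U'' φ‖ ≤ κ₂) (hU₃b : ∀ φ : EuclideanSpace ℝ ι, ‖U₃ φ‖ ≤ κ₃)
    (hU₄b : ∀ φ : EuclideanSpace ℝ ι, ‖U₄ φ‖ ≤ κ₄) (ψ₀ : EuclideanSpace ℝ ι) (hh : ‖h‖ ≤ 1) (hk : ‖k‖ ≤ 1) (hl : ‖l‖ ≤ 1) :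
    DifferentiableAt ℝ (fun ψ : EuclideanSpace ℝ ι => ((∫ ω : EuclideanSpace ℝ ι, exp (-U (ω + ψ)) ∂(multivariateGaussian 0 Γ)))⁻¹ * (∫ ω :
        EuclideanSpace ℝ ι, exp (-U (ω + ψ)) * (U₃ (ω + ψ) h k l - U' (ω + ψ) k * U'' (ω + ψ) h l - U'' (ω + ψ) h k * U' (ω + ψ) l - U' (ω + ψ) h *
        U'' (ω + ψ) k l + U' (ω + ψ) h * U' (ω + ψ) k * U' (ω + ψ) l) ∂(multivariateGaussian 0 Γ)) + ((∫ ω : EuclideanSpace ℝ ι, exp (-U (ω + ψ))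
        ∂(multivariateGaussian 0 Γ)) ^ 2)⁻¹ * (∫ ω : EuclideanSpace ℝ ι, exp (-U (ω + ψ)) * U' (ω + ψ) h ∂(multivariateGaussian 0 Γ)) * (∫ ω :
        EuclideanSpace ℝ ι, exp (-U (ω + ψ)) * (U'' (ω + ψ) k l - U' (ω + ψ) k * U' (ω + ψ) l) ∂(multivariateGaussian 0 Γ)) + ((∫ ω : EuclideanSpace
        ℝ ι, exp (-U (ω + ψ)) ∂(multivariateGaussian 0 Γ)) ^ 2)⁻¹ * (∫ ω : EuclideanSpace ℝ ι, exp (-U (ω + ψ)) * U' (ω + ψ) k ∂(multivariateGaussian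
        0 Γ)) * (∫ ω : EuclideanSpace ℝ ι, exp (-U (ω + ψ)) * (U'' (ω + ψ) h l - U' (ω + ψ) h * U' (ω + ψ) l) ∂(multivariateGaussian 0 Γ)) +
      (((∫ ω : EuclideanSpace ℝ ι, exp (-U (ω + ψ)) ∂(multivariateGaussian 0 Γ)) ^ 2)⁻¹ * (∫ ω : EuclideanSpace ℝ ι, exp (-U (ω + ψ)) * (U'' (ω + ψ)
          h k - U' (ω + ψ) h * U' (ω + ψ) k) ∂(multivariateGaussian 0 Γ)) + -2 / (∫ ω : EuclideanSpace ℝ ι, exp (-U (ω + ψ)) ∂(multivariateGaussian 0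
          Γ)) ^ 3 * -(∫ ω : EuclideanSpace ℝ ι, exp (-U (ω + ψ)) * U' (ω + ψ) h ∂(multivariateGaussian 0 Γ)) * (∫ ω : EuclideanSpace ℝ ι, exp (-U (ω
          + ψ)) * U' (ω + ψ) k ∂(multivariateGaussian 0 Γ))) * (∫ ω : EuclideanSpace ℝ ι, exp (-U (ω + ψ)) * U' (ω + ψ) l ∂(multivariateGaussian 0
          Γ))) ψ₀ := by
  have hU'c : Continuous U' := continuous_iff_continuousAt.2 fun φ => (hU'd φ).continuousAt
  have hU''c : Continuous U'' := continuous_iff_continuousAt.2 fun φ => (hU''d φ).continuousAt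
  have hU₃c : Continuous U₃ := continuous_iff_continuousAt.2 fun φ => (hU₃d φ).continuousAt
  have hz0 : (∫ ω : EuclideanSpace ℝ ι, exp (-U (ω + ψ₀)) ∂(multivariateGaussian 0 Γ)) ≠ 0 := (block_Z_pos hΓ hΓop Y hUd hκ₀ hτ hδ hθ0 hθ1 hκθ hstab
      ψ₀).ne'
  have hZ1 := hasFDerivAt_Z_scalar hΓ hΓop Y hUd hU'c hκ₀ hκ₁ ha hτ hδ hθ1 hκθ hstab hU'b ψ₀
  have hZ : DifferentiableAt ℝ (fun ψ : EuclideanSpace ℝ ι => ∫ ω : EuclideanSpace ℝ ι, exp (-U (ω + ψ)) ∂(multivariateGaussian 0 Γ)) ψ₀ := by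
    have h2 : HasFDerivAt (fun ψ : EuclideanSpace ℝ ι => ∫ ω : EuclideanSpace ℝ ι, exp (-U (ω + ψ)) ∂(multivariateGaussian 0 Γ))
        (∫ ω : EuclideanSpace ℝ ι, exp (-U (ω + ψ₀)) • ((0 : EuclideanSpace ℝ ι →L[ℝ] ℝ) - (1 : ℝ) • U' (ω + ψ₀)) ∂(multivariateGaussian 0 Γ)) ψ₀ :=
            by
      simpa only [mul_one] using hZ1
    exact h2.differentiableAt
  have hGh := (hasFDerivAt_G_scalar hΓ hΓop Y hUd hU'd hU''c hκ₀ hκ₁ ha hτ hδ hθ1 hκθ hstab hU'b hU''b ψ₀ h hh).differentiableAt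
  have hGk := (hasFDerivAt_G_scalar hΓ hΓop Y hUd hU'd hU''c hκ₀ hκ₁ ha hτ hδ hθ1 hκθ hstab hU'b hU''b ψ₀ k hk).differentiableAt
  have hGl := (hasFDerivAt_G_scalar hΓ hΓop Y hUd hU'd hU''c hκ₀ hκ₁ ha hτ hδ hθ1 hκθ hstab hU'b hU''b ψ₀ l hl).differentiableAt
  have hHkl := (hasFDerivAt_H_scalar hΓ hΓop Y hUd hU'd hU''d hU₃c hκ₀ hκ₁ ha hτ hδ hθ1 hκθ hstab hU'b hU''b hU₃b ψ₀ k l hk hl).differentiableAt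
  have hHhl := (hasFDerivAt_H_scalar hΓ hΓop Y hUd hU'd hU''d hU₃c hκ₀ hκ₁ ha hτ hδ hθ1 hκθ hstab hU'b hU''b hU₃b ψ₀ h l hh hl).differentiableAt
  have hHhk := (hasFDerivAt_H_scalar hΓ hΓop Y hUd hU'd hU''d hU₃c hκ₀ hκ₁ ha hτ hδ hθ1 hκθ hstab hU'b hU''b hU₃b ψ₀ h k hh hk).differentiableAt
  have hΦ := (hasFDerivAt_Phi_scalar hΓ hΓop Y hUd hU'd hU''d hU₃d hU₄c hκ₀ hκ₁ ha hτ hδ hθ1 hκθ hstab hU'b hU''b hU₃b hU₄b ψ₀ hh hk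
      hl).differentiableAt
  fun_prop (disch := first | assumption | exact pow_ne_zero _ hz0)

/-! ## §2. The Fréchet derivative on a direction is the centred display -/

/-- **THE FRÉCHET DERIVATIVE OF `T(·)[h,k,l]` ON A DIRECTION `m` IS (521)'s CENTRED DISPLAY** (restriction to the line `ψ₀ + sm` and uniqueness of
one-variable derivatives). [folklore] -/
theorem fderiv_third_form_apply (hΓ : Γ.PosSemidef) (hΓop : (γop • (1 : Matrix ι ι ℝ) - Γ).PosSemidef) (Y : Finset ι)
    (hUd : ∀ φ : EuclideanSpace ℝ ι, HasFDerivAt U (U' φ) φ) (hU'd : ∀ φ : EuclideanSpace ℝ ι, HasFDerivAt U' (U'' φ) φ)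
    (hU''d : ∀ φ : EuclideanSpace ℝ ι, HasFDerivAt U'' (U₃ φ) φ) (hU₃d : ∀ φ : EuclideanSpace ℝ ι, HasFDerivAt U₃ (U₄ φ) φ) (hU₄c : Continuous U₄)
    (hκ₀ : 0 ≤ κ₀) (hκ₁ : 0 ≤ κ₁) (ha : 0 ≤ a) (hτ : 0 < τ) (hδ : 0 < δ) (hθ1 : θ < 1) (hκθ : (2 * κ₀ * (1 + τ) + 4 * δ) * γop ≤ θ)
    (hstab : ∀ φ : EuclideanSpace ℝ ι, -(κ₀ * ∑ x ∈ Y, φ x ^ 2) ≤ U φ) (hU'b : ∀ φ : EuclideanSpace ℝ ι, ‖U' φ‖ ≤ κ₁ * (a + ∑ x ∈ Y, φ x ^ 2)) (hθ0 :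
        0 < θ) (hU''b : ∀ φ : EuclideanSpace ℝ ι, ‖U'' φ‖ ≤ κ₂) (hU₃b : ∀ φ : EuclideanSpace ℝ ι, ‖U₃ φ‖ ≤ κ₃)
    (hU₄b : ∀ φ : EuclideanSpace ℝ ι, ‖U₄ φ‖ ≤ κ₄) (ψ₀ : EuclideanSpace ℝ ι) (hh : ‖h‖ ≤ 1) (hk : ‖k‖ ≤ 1) (hl : ‖l‖ ≤ 1) (m : EuclideanSpace ℝ ι) :
    (fderiv ℝ (fun ψ : EuclideanSpace ℝ ι => ((∫ ω : EuclideanSpace ℝ ι, exp (-U (ω + ψ)) ∂(multivariateGaussian 0 Γ)))⁻¹ * (∫ ω : EuclideanSpace ℝ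
        ι, exp (-U (ω + ψ)) * (U₃ (ω + ψ) h k l - U' (ω + ψ) k * U'' (ω + ψ) h l - U'' (ω + ψ) h k * U' (ω + ψ) l - U' (ω + ψ) h * U'' (ω + ψ) k l +
        U' (ω + ψ) h * U' (ω + ψ) k * U' (ω + ψ) l) ∂(multivariateGaussian 0 Γ)) + ((∫ ω : EuclideanSpace ℝ ι, exp (-U (ω + ψ))
        ∂(multivariateGaussian 0 Γ)) ^ 2)⁻¹ * (∫ ω : EuclideanSpace ℝ ι, exp (-U (ω + ψ)) * U' (ω + ψ) h ∂(multivariateGaussian 0 Γ)) * (∫ ω :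
        EuclideanSpace ℝ ι, exp (-U (ω + ψ)) * (U'' (ω + ψ) k l - U' (ω + ψ) k * U' (ω + ψ) l) ∂(multivariateGaussian 0 Γ)) + ((∫ ω : EuclideanSpace
        ℝ ι, exp (-U (ω + ψ)) ∂(multivariateGaussian 0 Γ)) ^ 2)⁻¹ * (∫ ω : EuclideanSpace ℝ ι, exp (-U (ω + ψ)) * U' (ω + ψ) k ∂(multivariateGaussian
        0 Γ)) * (∫ ω : EuclideanSpace ℝ ι, exp (-U (ω + ψ)) * (U'' (ω + ψ) h l - U' (ω + ψ) h * U' (ω + ψ) l) ∂(multivariateGaussian 0 Γ)) +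
      (((∫ ω : EuclideanSpace ℝ ι, exp (-U (ω + ψ)) ∂(multivariateGaussian 0 Γ)) ^ 2)⁻¹ * (∫ ω : EuclideanSpace ℝ ι, exp (-U (ω + ψ)) * (U'' (ω + ψ)
          h k - U' (ω + ψ) h * U' (ω + ψ) k) ∂(multivariateGaussian 0 Γ)) + -2 / (∫ ω : EuclideanSpace ℝ ι, exp (-U (ω + ψ)) ∂(multivariateGaussian 0
          Γ)) ^ 3 * -(∫ ω : EuclideanSpace ℝ ι, exp (-U (ω + ψ)) * U' (ω + ψ) h ∂(multivariateGaussian 0 Γ)) * (∫ ω : EuclideanSpace ℝ ι, exp (-U (ω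
          + ψ)) * U' (ω + ψ) k ∂(multivariateGaussian 0 Γ))) * (∫ ω : EuclideanSpace ℝ ι, exp (-U (ω + ψ)) * U' (ω + ψ) l ∂(multivariateGaussian 0
          Γ))) ψ₀) m =
      (∫ ω : EuclideanSpace ℝ ι, exp (-U (ω + ψ₀)) ∂(multivariateGaussian 0 Γ))⁻¹ * (∫ ω : EuclideanSpace ℝ ι, exp (-U (ω + ψ₀)) * U₄ (ω + ψ₀) m h k
          l ∂(multivariateGaussian 0 Γ)) -
        (((∫ ω : EuclideanSpace ℝ ι, exp (-U (ω + ψ₀)) ∂(multivariateGaussian 0 Γ))⁻¹ * (∫ ω : EuclideanSpace ℝ ι, exp (-U (ω + ψ₀)) * (U₃ (ω + ψ₀) m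
            k l * U' (ω + ψ₀) h) ∂(multivariateGaussian 0 Γ)) - ((∫ ω : EuclideanSpace ℝ ι, exp (-U (ω + ψ₀)) ∂(multivariateGaussian 0 Γ)) ^ 2)⁻¹ *
            ((∫ ω : EuclideanSpace ℝ ι, exp (-U (ω + ψ₀)) * U₃ (ω + ψ₀) m k l ∂(multivariateGaussian 0 Γ)) * (∫ ω : EuclideanSpace ℝ ι, exp (-U (ω +
            ψ₀)) * U' (ω + ψ₀) h ∂(multivariateGaussian 0 Γ)))) + ((∫ ω : EuclideanSpace ℝ ι, exp (-U (ω + ψ₀)) ∂(multivariateGaussian 0 Γ))⁻¹ * (∫ ω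
            : EuclideanSpace ℝ ι, exp (-U (ω + ψ₀)) * (U₃ (ω + ψ₀) m h l * U' (ω + ψ₀) k) ∂(multivariateGaussian 0 Γ)) - ((∫ ω : EuclideanSpace ℝ ι,
            exp (-U (ω + ψ₀)) ∂(multivariateGaussian 0 Γ)) ^ 2)⁻¹ * ((∫ ω : EuclideanSpace ℝ ι, exp (-U (ω + ψ₀)) * U₃ (ω + ψ₀) m h l
            ∂(multivariateGaussian 0 Γ)) * (∫ ω : EuclideanSpace ℝ ι, exp (-U (ω + ψ₀)) * U' (ω + ψ₀) k ∂(multivariateGaussian 0 Γ)))) + ((∫ ω :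
            EuclideanSpace ℝ ι, exp (-U (ω + ψ₀)) ∂(multivariateGaussian 0 Γ))⁻¹ * (∫ ω : EuclideanSpace ℝ ι, exp (-U (ω + ψ₀)) * (U₃ (ω + ψ₀) m h k
            * U' (ω + ψ₀) l) ∂(multivariateGaussian 0 Γ)) - ((∫ ω : EuclideanSpace ℝ ι, exp (-U (ω + ψ₀)) ∂(multivariateGaussian 0 Γ)) ^ 2)⁻¹ * ((∫ ω
            : EuclideanSpace ℝ ι, exp (-U (ω + ψ₀)) * U₃ (ω + ψ₀) m h k ∂(multivariateGaussian 0 Γ)) * (∫ ω : EuclideanSpace ℝ ι, exp (-U (ω + ψ₀)) *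
            U' (ω + ψ₀) l ∂(multivariateGaussian 0 Γ)))) + ((∫ ω : EuclideanSpace ℝ ι, exp (-U (ω + ψ₀)) ∂(multivariateGaussian 0 Γ))⁻¹ * (∫ ω :
            EuclideanSpace ℝ ι, exp (-U (ω + ψ₀)) * (U' (ω + ψ₀) m * U₃ (ω + ψ₀) h k l) ∂(multivariateGaussian 0 Γ)) - ((∫ ω : EuclideanSpace ℝ ι,
            exp (-U (ω + ψ₀)) ∂(multivariateGaussian 0 Γ)) ^ 2)⁻¹ * ((∫ ω : EuclideanSpace ℝ ι, exp (-U (ω + ψ₀)) * U' (ω + ψ₀) m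
            ∂(multivariateGaussian 0 Γ)) * (∫ ω : EuclideanSpace ℝ ι, exp (-U (ω + ψ₀)) * U₃ (ω + ψ₀) h k l ∂(multivariateGaussian 0 Γ))))) -
        (((∫ ω : EuclideanSpace ℝ ι, exp (-U (ω + ψ₀)) ∂(multivariateGaussian 0 Γ))⁻¹ * (∫ ω : EuclideanSpace ℝ ι, exp (-U (ω + ψ₀)) * (U'' (ω + ψ₀)
            m h * U'' (ω + ψ₀) k l) ∂(multivariateGaussian 0 Γ)) - ((∫ ω : EuclideanSpace ℝ ι, exp (-U (ω + ψ₀)) ∂(multivariateGaussian 0 Γ)) ^ 2)⁻¹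
            * ((∫ ω : EuclideanSpace ℝ ι, exp (-U (ω + ψ₀)) * U'' (ω + ψ₀) m h ∂(multivariateGaussian 0 Γ)) * (∫ ω : EuclideanSpace ℝ ι, exp (-U (ω +
            ψ₀)) * U'' (ω + ψ₀) k l ∂(multivariateGaussian 0 Γ)))) + ((∫ ω : EuclideanSpace ℝ ι, exp (-U (ω + ψ₀)) ∂(multivariateGaussian 0 Γ))⁻¹ *
            (∫ ω : EuclideanSpace ℝ ι, exp (-U (ω + ψ₀)) * (U'' (ω + ψ₀) m k * U'' (ω + ψ₀) h l) ∂(multivariateGaussian 0 Γ)) - ((∫ ω :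
            EuclideanSpace ℝ ι, exp (-U (ω + ψ₀)) ∂(multivariateGaussian 0 Γ)) ^ 2)⁻¹ * ((∫ ω : EuclideanSpace ℝ ι, exp (-U (ω + ψ₀)) * U'' (ω + ψ₀)
            m k ∂(multivariateGaussian 0 Γ)) * (∫ ω : EuclideanSpace ℝ ι, exp (-U (ω + ψ₀)) * U'' (ω + ψ₀) h l ∂(multivariateGaussian 0 Γ)))) + ((∫ ω
            : EuclideanSpace ℝ ι, exp (-U (ω + ψ₀)) ∂(multivariateGaussian 0 Γ))⁻¹ * (∫ ω : EuclideanSpace ℝ ι, exp (-U (ω + ψ₀)) * (U'' (ω + ψ₀) m l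
            * U'' (ω + ψ₀) h k) ∂(multivariateGaussian 0 Γ)) - ((∫ ω : EuclideanSpace ℝ ι, exp (-U (ω + ψ₀)) ∂(multivariateGaussian 0 Γ)) ^ 2)⁻¹ *
            ((∫ ω : EuclideanSpace ℝ ι, exp (-U (ω + ψ₀)) * U'' (ω + ψ₀) m l ∂(multivariateGaussian 0 Γ)) * (∫ ω : EuclideanSpace ℝ ι, exp (-U (ω +
            ψ₀)) * U'' (ω + ψ₀) h k ∂(multivariateGaussian 0 Γ))))) +
        ((∫ ω : EuclideanSpace ℝ ι, exp (-U (ω + ψ₀)) ∂(multivariateGaussian 0 Γ))⁻¹ * (∫ ω : EuclideanSpace ℝ ι, exp (-U (ω + ψ₀)) * ((U'' (ω + ψ₀)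
            m h - ((∫ ω : EuclideanSpace ℝ ι, exp (-U (ω + ψ₀)) ∂(multivariateGaussian 0 Γ))⁻¹ * (∫ ω : EuclideanSpace ℝ ι, exp (-U (ω + ψ₀)) * U''
            (ω + ψ₀) m h ∂(multivariateGaussian 0 Γ)))) * (U' (ω + ψ₀) k - ((∫ ω : EuclideanSpace ℝ ι, exp (-U (ω + ψ₀)) ∂(multivariateGaussian 0
            Γ))⁻¹ * (∫ ω : EuclideanSpace ℝ ι, exp (-U (ω + ψ₀)) * U' (ω + ψ₀) k ∂(multivariateGaussian 0 Γ)))) * (U' (ω + ψ₀) l - ((∫ ω :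
            EuclideanSpace ℝ ι, exp (-U (ω + ψ₀)) ∂(multivariateGaussian 0 Γ))⁻¹ * (∫ ω : EuclideanSpace ℝ ι, exp (-U (ω + ψ₀)) * U' (ω + ψ₀) l
            ∂(multivariateGaussian 0 Γ))))) ∂(multivariateGaussian 0 Γ)) + (∫ ω : EuclideanSpace ℝ ι, exp (-U (ω + ψ₀)) ∂(multivariateGaussian 0
            Γ))⁻¹ * (∫ ω : EuclideanSpace ℝ ι, exp (-U (ω + ψ₀)) * ((U'' (ω + ψ₀) m k - ((∫ ω : EuclideanSpace ℝ ι, exp (-U (ω + ψ₀))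
            ∂(multivariateGaussian 0 Γ))⁻¹ * (∫ ω : EuclideanSpace ℝ ι, exp (-U (ω + ψ₀)) * U'' (ω + ψ₀) m k ∂(multivariateGaussian 0 Γ)))) * (U' (ω
            + ψ₀) h - ((∫ ω : EuclideanSpace ℝ ι, exp (-U (ω + ψ₀)) ∂(multivariateGaussian 0 Γ))⁻¹ * (∫ ω : EuclideanSpace ℝ ι, exp (-U (ω + ψ₀)) *
            U' (ω + ψ₀) h ∂(multivariateGaussian 0 Γ)))) * (U' (ω + ψ₀) l - ((∫ ω : EuclideanSpace ℝ ι, exp (-U (ω + ψ₀)) ∂(multivariateGaussian 0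
            Γ))⁻¹ * (∫ ω : EuclideanSpace ℝ ι, exp (-U (ω + ψ₀)) * U' (ω + ψ₀) l ∂(multivariateGaussian 0 Γ))))) ∂(multivariateGaussian 0 Γ)) + (∫ ω
            : EuclideanSpace ℝ ι, exp (-U (ω + ψ₀)) ∂(multivariateGaussian 0 Γ))⁻¹ * (∫ ω : EuclideanSpace ℝ ι, exp (-U (ω + ψ₀)) * ((U'' (ω + ψ₀) m
            l - ((∫ ω : EuclideanSpace ℝ ι, exp (-U (ω + ψ₀)) ∂(multivariateGaussian 0 Γ))⁻¹ * (∫ ω : EuclideanSpace ℝ ι, exp (-U (ω + ψ₀)) * U'' (ω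
            + ψ₀) m l ∂(multivariateGaussian 0 Γ)))) * (U' (ω + ψ₀) h - ((∫ ω : EuclideanSpace ℝ ι, exp (-U (ω + ψ₀)) ∂(multivariateGaussian 0 Γ))⁻¹
            * (∫ ω : EuclideanSpace ℝ ι, exp (-U (ω + ψ₀)) * U' (ω + ψ₀) h ∂(multivariateGaussian 0 Γ)))) * (U' (ω + ψ₀) k - ((∫ ω : EuclideanSpace ℝ
            ι, exp (-U (ω + ψ₀)) ∂(multivariateGaussian 0 Γ))⁻¹ * (∫ ω : EuclideanSpace ℝ ι, exp (-U (ω + ψ₀)) * U' (ω + ψ₀) k ∂(multivariateGaussian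
            0 Γ))))) ∂(multivariateGaussian 0 Γ)) + (∫ ω : EuclideanSpace ℝ ι, exp (-U (ω + ψ₀)) ∂(multivariateGaussian 0 Γ))⁻¹ * (∫ ω :
            EuclideanSpace ℝ ι, exp (-U (ω + ψ₀)) * ((U' (ω + ψ₀) m - ((∫ ω : EuclideanSpace ℝ ι, exp (-U (ω + ψ₀)) ∂(multivariateGaussian 0 Γ))⁻¹ *
            (∫ ω : EuclideanSpace ℝ ι, exp (-U (ω + ψ₀)) * U' (ω + ψ₀) m ∂(multivariateGaussian 0 Γ)))) * (U'' (ω + ψ₀) h k - ((∫ ω : EuclideanSpace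
            ℝ ι, exp (-U (ω + ψ₀)) ∂(multivariateGaussian 0 Γ))⁻¹ * (∫ ω : EuclideanSpace ℝ ι, exp (-U (ω + ψ₀)) * U'' (ω + ψ₀) h k
            ∂(multivariateGaussian 0 Γ)))) * (U' (ω + ψ₀) l - ((∫ ω : EuclideanSpace ℝ ι, exp (-U (ω + ψ₀)) ∂(multivariateGaussian 0 Γ))⁻¹ * (∫ ω :
            EuclideanSpace ℝ ι, exp (-U (ω + ψ₀)) * U' (ω + ψ₀) l ∂(multivariateGaussian 0 Γ))))) ∂(multivariateGaussian 0 Γ)) + (∫ ω :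
            EuclideanSpace ℝ ι, exp (-U (ω + ψ₀)) ∂(multivariateGaussian 0 Γ))⁻¹ * (∫ ω : EuclideanSpace ℝ ι, exp (-U (ω + ψ₀)) * ((U' (ω + ψ₀) m -
            ((∫ ω : EuclideanSpace ℝ ι, exp (-U (ω + ψ₀)) ∂(multivariateGaussian 0 Γ))⁻¹ * (∫ ω : EuclideanSpace ℝ ι, exp (-U (ω + ψ₀)) * U' (ω + ψ₀)
            m ∂(multivariateGaussian 0 Γ)))) * (U'' (ω + ψ₀) h l - ((∫ ω : EuclideanSpace ℝ ι, exp (-U (ω + ψ₀)) ∂(multivariateGaussian 0 Γ))⁻¹ * (∫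
            ω : EuclideanSpace ℝ ι, exp (-U (ω + ψ₀)) * U'' (ω + ψ₀) h l ∂(multivariateGaussian 0 Γ)))) * (U' (ω + ψ₀) k - ((∫ ω : EuclideanSpace ℝ
            ι, exp (-U (ω + ψ₀)) ∂(multivariateGaussian 0 Γ))⁻¹ * (∫ ω : EuclideanSpace ℝ ι, exp (-U (ω + ψ₀)) * U' (ω + ψ₀) k ∂(multivariateGaussian
            0 Γ))))) ∂(multivariateGaussian 0 Γ)) + (∫ ω : EuclideanSpace ℝ ι, exp (-U (ω + ψ₀)) ∂(multivariateGaussian 0 Γ))⁻¹ * (∫ ω :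
            EuclideanSpace ℝ ι, exp (-U (ω + ψ₀)) * ((U' (ω + ψ₀) m - ((∫ ω : EuclideanSpace ℝ ι, exp (-U (ω + ψ₀)) ∂(multivariateGaussian 0 Γ))⁻¹ *
            (∫ ω : EuclideanSpace ℝ ι, exp (-U (ω + ψ₀)) * U' (ω + ψ₀) m ∂(multivariateGaussian 0 Γ)))) * (U'' (ω + ψ₀) k l - ((∫ ω : EuclideanSpace
            ℝ ι, exp (-U (ω + ψ₀)) ∂(multivariateGaussian 0 Γ))⁻¹ * (∫ ω : EuclideanSpace ℝ ι, exp (-U (ω + ψ₀)) * U'' (ω + ψ₀) k l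
            ∂(multivariateGaussian 0 Γ)))) * (U' (ω + ψ₀) h - ((∫ ω : EuclideanSpace ℝ ι, exp (-U (ω + ψ₀)) ∂(multivariateGaussian 0 Γ))⁻¹ * (∫ ω :
            EuclideanSpace ℝ ι, exp (-U (ω + ψ₀)) * U' (ω + ψ₀) h ∂(multivariateGaussian 0 Γ))))) ∂(multivariateGaussian 0 Γ))) -
        ((∫ ω : EuclideanSpace ℝ ι, exp (-U (ω + ψ₀)) ∂(multivariateGaussian 0 Γ))⁻¹ * (∫ ω : EuclideanSpace ℝ ι, exp (-U (ω + ψ₀)) * ((U' (ω + ψ₀) m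
            - ((∫ ω : EuclideanSpace ℝ ι, exp (-U (ω + ψ₀)) ∂(multivariateGaussian 0 Γ))⁻¹ * (∫ ω : EuclideanSpace ℝ ι, exp (-U (ω + ψ₀)) * U' (ω +
            ψ₀) m ∂(multivariateGaussian 0 Γ)))) * (U' (ω + ψ₀) h - ((∫ ω : EuclideanSpace ℝ ι, exp (-U (ω + ψ₀)) ∂(multivariateGaussian 0 Γ))⁻¹ * (∫
            ω : EuclideanSpace ℝ ι, exp (-U (ω + ψ₀)) * U' (ω + ψ₀) h ∂(multivariateGaussian 0 Γ)))) * (U' (ω + ψ₀) k - ((∫ ω : EuclideanSpace ℝ ι,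
            exp (-U (ω + ψ₀)) ∂(multivariateGaussian 0 Γ))⁻¹ * (∫ ω : EuclideanSpace ℝ ι, exp (-U (ω + ψ₀)) * U' (ω + ψ₀) k ∂(multivariateGaussian 0
            Γ)))) * (U' (ω + ψ₀) l - ((∫ ω : EuclideanSpace ℝ ι, exp (-U (ω + ψ₀)) ∂(multivariateGaussian 0 Γ))⁻¹ * (∫ ω : EuclideanSpace ℝ ι, exp
            (-U (ω + ψ₀)) * U' (ω + ψ₀) l ∂(multivariateGaussian 0 Γ))))) ∂(multivariateGaussian 0 Γ)) - ((∫ ω : EuclideanSpace ℝ ι, exp (-U (ω +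
            ψ₀)) ∂(multivariateGaussian 0 Γ))⁻¹ * (∫ ω : EuclideanSpace ℝ ι, exp (-U (ω + ψ₀)) * ((U' (ω + ψ₀) m - ((∫ ω : EuclideanSpace ℝ ι, exp
            (-U (ω + ψ₀)) ∂(multivariateGaussian 0 Γ))⁻¹ * (∫ ω : EuclideanSpace ℝ ι, exp (-U (ω + ψ₀)) * U' (ω + ψ₀) m ∂(multivariateGaussian 0
            Γ)))) * (U' (ω + ψ₀) h - ((∫ ω : EuclideanSpace ℝ ι, exp (-U (ω + ψ₀)) ∂(multivariateGaussian 0 Γ))⁻¹ * (∫ ω : EuclideanSpace ℝ ι, exp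
            (-U (ω + ψ₀)) * U' (ω + ψ₀) h ∂(multivariateGaussian 0 Γ))))) ∂(multivariateGaussian 0 Γ))) * ((∫ ω : EuclideanSpace ℝ ι, exp (-U (ω +
            ψ₀)) ∂(multivariateGaussian 0 Γ))⁻¹ * (∫ ω : EuclideanSpace ℝ ι, exp (-U (ω + ψ₀)) * ((U' (ω + ψ₀) k - ((∫ ω : EuclideanSpace ℝ ι, exp
            (-U (ω + ψ₀)) ∂(multivariateGaussian 0 Γ))⁻¹ * (∫ ω : EuclideanSpace ℝ ι, exp (-U (ω + ψ₀)) * U' (ω + ψ₀) k ∂(multivariateGaussian 0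
            Γ)))) * (U' (ω + ψ₀) l - ((∫ ω : EuclideanSpace ℝ ι, exp (-U (ω + ψ₀)) ∂(multivariateGaussian 0 Γ))⁻¹ * (∫ ω : EuclideanSpace ℝ ι, exp
            (-U (ω + ψ₀)) * U' (ω + ψ₀) l ∂(multivariateGaussian 0 Γ))))) ∂(multivariateGaussian 0 Γ))) - ((∫ ω : EuclideanSpace ℝ ι, exp (-U (ω +
            ψ₀)) ∂(multivariateGaussian 0 Γ))⁻¹ * (∫ ω : EuclideanSpace ℝ ι, exp (-U (ω + ψ₀)) * ((U' (ω + ψ₀) m - ((∫ ω : EuclideanSpace ℝ ι, exp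
            (-U (ω + ψ₀)) ∂(multivariateGaussian 0 Γ))⁻¹ * (∫ ω : EuclideanSpace ℝ ι, exp (-U (ω + ψ₀)) * U' (ω + ψ₀) m ∂(multivariateGaussian 0
            Γ)))) * (U' (ω + ψ₀) k - ((∫ ω : EuclideanSpace ℝ ι, exp (-U (ω + ψ₀)) ∂(multivariateGaussian 0 Γ))⁻¹ * (∫ ω : EuclideanSpace ℝ ι, exp
            (-U (ω + ψ₀)) * U' (ω + ψ₀) k ∂(multivariateGaussian 0 Γ))))) ∂(multivariateGaussian 0 Γ))) * ((∫ ω : EuclideanSpace ℝ ι, exp (-U (ω +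
            ψ₀)) ∂(multivariateGaussian 0 Γ))⁻¹ * (∫ ω : EuclideanSpace ℝ ι, exp (-U (ω + ψ₀)) * ((U' (ω + ψ₀) h - ((∫ ω : EuclideanSpace ℝ ι, exp
            (-U (ω + ψ₀)) ∂(multivariateGaussian 0 Γ))⁻¹ * (∫ ω : EuclideanSpace ℝ ι, exp (-U (ω + ψ₀)) * U' (ω + ψ₀) h ∂(multivariateGaussian 0
            Γ)))) * (U' (ω + ψ₀) l - ((∫ ω : EuclideanSpace ℝ ι, exp (-U (ω + ψ₀)) ∂(multivariateGaussian 0 Γ))⁻¹ * (∫ ω : EuclideanSpace ℝ ι, exp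
            (-U (ω + ψ₀)) * U' (ω + ψ₀) l ∂(multivariateGaussian 0 Γ))))) ∂(multivariateGaussian 0 Γ))) - ((∫ ω : EuclideanSpace ℝ ι, exp (-U (ω +
            ψ₀)) ∂(multivariateGaussian 0 Γ))⁻¹ * (∫ ω : EuclideanSpace ℝ ι, exp (-U (ω + ψ₀)) * ((U' (ω + ψ₀) m - ((∫ ω : EuclideanSpace ℝ ι, exp
            (-U (ω + ψ₀)) ∂(multivariateGaussian 0 Γ))⁻¹ * (∫ ω : EuclideanSpace ℝ ι, exp (-U (ω + ψ₀)) * U' (ω + ψ₀) m ∂(multivariateGaussian 0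
            Γ)))) * (U' (ω + ψ₀) l - ((∫ ω : EuclideanSpace ℝ ι, exp (-U (ω + ψ₀)) ∂(multivariateGaussian 0 Γ))⁻¹ * (∫ ω : EuclideanSpace ℝ ι, exp
            (-U (ω + ψ₀)) * U' (ω + ψ₀) l ∂(multivariateGaussian 0 Γ))))) ∂(multivariateGaussian 0 Γ))) * ((∫ ω : EuclideanSpace ℝ ι, exp (-U (ω +
            ψ₀)) ∂(multivariateGaussian 0 Γ))⁻¹ * (∫ ω : EuclideanSpace ℝ ι, exp (-U (ω + ψ₀)) * ((U' (ω + ψ₀) h - ((∫ ω : EuclideanSpace ℝ ι, exp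
            (-U (ω + ψ₀)) ∂(multivariateGaussian 0 Γ))⁻¹ * (∫ ω : EuclideanSpace ℝ ι, exp (-U (ω + ψ₀)) * U' (ω + ψ₀) h ∂(multivariateGaussian 0
            Γ)))) * (U' (ω + ψ₀) k - ((∫ ω : EuclideanSpace ℝ ι, exp (-U (ω + ψ₀)) ∂(multivariateGaussian 0 Γ))⁻¹ * (∫ ω : EuclideanSpace ℝ ι, exp
            (-U (ω + ψ₀)) * U' (ω + ψ₀) k ∂(multivariateGaussian 0 Γ))))) ∂(multivariateGaussian 0 Γ)))) := by
  have h1 := (differentiableAt_third_form hΓ hΓop Y hUd hU'd hU''d hU₃d hU₄c hκ₀ hκ₁ ha hτ hδ hθ1 hκθ hstab hU'b hθ0 hU''b hU₃b hU₄b ψ₀ hh hk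
      hl).hasFDerivAt
  have h2 := hasDerivAt_along_line h1 m
  have h3 := hasDerivAt_third_form_line_centred hΓ hΓop Y hUd hU'd hU''d hU₃d hU₄c hκ₀ hκ₁ ha hτ hδ hθ1 hκθ hstab hU'b hθ0 hU''b hU₃b hU₄b ψ₀ hh hk
      hl m
  exact h2.unique h3

end Main

/-! ## §3. Toy -/

/-- Toy (§2's uniqueness step in one variable): two derivatives of the same function at the same point agree. -/
example (f : ℝ → ℝ) (a b : ℝ) (h1 : HasDerivAt f a 0) (h2 : HasDerivAt f b 0) : a = b := h1.unique h2

end Summit.QuantumFields.BalabanUV.T4Continuum.NE7b.SupThirdFormDifferentiable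

end
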